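import Summits.KontsevichZagierPeriods.KontsevichZagierPeriods.Theorems.RootDecompZetaThreeFrontierSupportCollapseGenusZero

/-!
# Route RootDecompZetaThreeFrontier / RootDecompWeightFrontier — support collapse for item 27223 `HigherWeightDescent` — part 2/3 (`…SupportCollapse`): the Newton–Leibniz band package (private), `gzDen_insertNth`, ELIMINATING one pole-free variable (`eliminate`) and SUPPORT COLLAPSE (`supportCollapse`)

Theorems-split (3 files ≤ 400 lines, sequential imports) of the decomp-kz lens-1 gen-6 file
`run/shared/lean/pub/decomp-kz/decomp-kz-lens-1/g6/landing/RootDecompZetaThreeFrontierSupportCollapse.lean` (= SupportCollapse.lean @3ef2cb59,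
882 lines; lens farm rc 0 / 0 err / 0 warn / 0 sorry, standard axioms; critic decomp-kz-crit-1 g2 CLEARED 2026-08-30T06:31:48Z; landing ask L9 of the
writer), landed by the census seat decomp-kz-census-1 g6 (--supports stmt-KontsevichZagierPeriods-27223). Content: pole-free variables of a genus-zero
representation are ELIMINATED INSIDE the KZ calculus (rule-2 reindexing + ONE rule-3 Newton–Leibniz move over the band `lo < t < hi` with a RATIONAL
primitive), so the `ν ≤ 3` column of `HigherWeightDescent` (item 27223; all weights, all `k ≥ 4`) is a THEOREM and the item is EQUIVALENT to its
saturated re-cut. The Newton–Leibniz package of `…JanusBands.IntegrateOut` (item 3915; module unbuilt on the farm today) is carried as PRIVATE copies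
in part 2. [Kontsevich–Zagier 2001 §1.2] Standard axioms, 0 sorry.
-/

noncomputable section

set_option linter.dupNamespace false

open Set MeasureTheory MvPolynomial
open Literature.NumberTheory.Transcendental
open Literature.ModelTheory.ExponentialFields

namespace Summit.KontsevichZagierPeriods.KontsevichZagierPeriods.Theorems.RootDecompZetaThreeFrontierSupportCollapse

variable {k : ℕ}

/-- `t ↦ Fin.snoc x t` is continuous. [folklore] -/
private theorem continuous_snoc {N : ℕ} (x : Fin N → ℝ) :
    Continuous fun t : ℝ => (Fin.snoc x t : Fin (N + 1) → ℝ) := by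
  refine continuous_pi fun j => ?_
  refine Fin.lastCases ?_ (fun i => ?_) j
  · simpa using continuous_id'
  · simpa using continuous_const

/-- Splitting off the last coordinate, `ℝ^{N+1} ≃ ℝ^N × ℝ`, as a volume-preserving measurable
equivalence with inverse `(x, t) ↦ Fin.snoc x t`. [folklore] -/
private theorem exists_measurableEquiv_snoc (N : ℕ) :
    ∃ e : (Fin (N + 1) → ℝ) ≃ᵐ (Fin N → ℝ) × ℝ,
      MeasurePreserving e volume ((volume : Measure (Fin N → ℝ)).prod (volume : Measure ℝ)) ∧
      ∀ q, e.symm q = Fin.snoc q.1 q.2 := by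
  refine ⟨(MeasurableEquiv.piFinSuccAbove (fun _ => ℝ) (Fin.last N)).trans
    MeasurableEquiv.prodComm, ?_, fun q => ?_⟩
  · refine (volume_preserving_piFinSuccAbove (fun _ => ℝ) (Fin.last N)).trans ?_
    rw [Measure.volume_eq_prod]
    exact Measure.measurePreserving_swap
  · show (MeasurableEquiv.piFinSuccAbove (fun _ => ℝ) (Fin.last N)).symm (q.2, q.1) = _
    rw [MeasurableEquiv.piFinSuccAbove_symm_apply, Fin.insertNthEquiv_last]
    rfl

/-- **Newton–Leibniz over an open band, packaged.** Let `r` be a representation whose domain is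
the open band `{(x, t) | x ∈ τ, a x < t < b x}` over a semialgebraic base `τ` with semialgebraic
`a < b`, and whose integrand agrees there with `f`; let `F`, `f` be semialgebraic on the closed band;
suppose `t ↦ F (x, t)` is continuous on `[a x, b x]` with derivative `f (x, ·)` on `(a x, b x)`
for `x ∈ τ`. Then `[r] ≡ [τ, F (x, b x) − F (x, a x)]` modulo relations; the base integrand is
absolutely integrable by Fubini and the fundamental theorem of calculus.
[Kontsevich–Zagier 2001, §1.2, rule (3)] [folklore] (verbatim copy of
`Summit.KontsevichZagierPeriods.ArrangementNormalForm.JanusBands.IntegrateOut.newtonLeibniz_pack`) -/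
private theorem newtonLeibniz_pack {N : ℕ} {τ : Set (Fin N → ℝ)} (hτ : IsSemialgebraic ℚ τ)
    {a b : (Fin N → ℝ) → ℝ} (ha : IsSemialgebraicFunOn ℚ τ a) (hb : IsSemialgebraicFunOn ℚ τ b)
    (hab : ∀ x ∈ τ, a x < b x) {f F : (Fin (N + 1) → ℝ) → ℝ}
    (hf : IsSemialgebraicFunOn ℚ (KZlog.band τ a b) f)
    (hF : IsSemialgebraicFunOn ℚ (KZlog.band τ a b) F)
    (hcont : ∀ x ∈ τ, ContinuousOn (fun t => F (Fin.snoc x t)) (Icc (a x) (b x)))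
    (hder : ∀ x ∈ τ, ∀ t ∈ Ioo (a x) (b x),
      HasDerivAt (fun s => F (Fin.snoc x s)) (f (Fin.snoc x t)) t)
    (r : KZ.IntegralRep (N + 1))
    (hrd : r.domain = {z | (Fin.init z : Fin N → ℝ) ∈ τ ∧ a (Fin.init z) < z (Fin.last N) ∧
      z (Fin.last N) < b (Fin.init z)})
    (hri : EqOn r.integrand f r.domain) :
    ∃ r' : KZ.IntegralRep N, r'.domain = τ ∧
      (r'.integrand = fun x => F (Fin.snoc x (b x)) - F (Fin.snoc x (a x))) ∧
      KZ.of r - KZ.of r' ∈ KZ.relations := by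
  have hτm : MeasurableSet τ := IsSemialgebraic.measurableSet_holds hτ
  have hBsa : IsSemialgebraic ℚ (KZlog.band τ a b) := KZlog.isSemialgebraic_band ha hb
  have hBm : MeasurableSet (KZlog.band τ a b) := IsSemialgebraic.measurableSet_holds hBsa
  have hsub : r.domain ⊆ KZlog.band τ a b := by
    rw [hrd]; exact fun z hz => ⟨hz.1, hz.2.1.le, hz.2.2.le⟩
  have hdiff : KZlog.band τ a b \ r.domain ⊆
      {z | (Fin.init z : Fin N → ℝ) ∈ τ ∧ z (Fin.last N) = a (Fin.init z)} ∪
        {z | (Fin.init z : Fin N → ℝ) ∈ τ ∧ z (Fin.last N) = b (Fin.init z)} := by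
    rw [hrd]
    rintro z ⟨⟨hzτ, h1, h2⟩, hz⟩
    simp only [mem_setOf_eq, not_and, not_lt] at hz
    rcases h1.lt_or_eq with h1 | h1
    · exact Or.inr ⟨hzτ, le_antisymm h2 (hz hzτ h1)⟩
    · exact Or.inl ⟨hzτ, h1.symm⟩
  have hnull : volume (KZlog.band τ a b \ r.domain) = 0 :=
    measure_mono_null hdiff (measure_union_null (KZ.volume_graph_eq_zero ha)
      (KZ.volume_graph_eq_zero hb))
  have hfO : IntegrableOn f r.domain :=
    r.integrableOn.congr_fun hri (KZ.IntegralRep.measurableSet_domain_holds r)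
  have hfB : IntegrableOn f (KZlog.band τ a b) := by
    rw [← Set.union_sdiff_cancel hsub]
    exact integrableOn_union.mpr ⟨hfO, IntegrableOn.of_measure_zero hnull⟩
  let r₂ : KZ.IntegralRep (N + 1) := ⟨KZlog.band τ a b, f, hBsa, hf, hfB⟩
  have h12 : KZ.of r - KZ.of r₂ ∈ KZ.relations := by
    refine KZ.of_sub_of_mem_relations_of_null r r₂ ?_ hnull fun z hz => hri hz.1
    rw [Set.sdiff_eq_empty.mpr hsub, measure_empty]
  -- the base integrand and its semialgebraicity
  have hmap : ∀ {c : (Fin N → ℝ) → ℝ}, IsSemialgebraicFunOn ℚ τ c →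
      (∀ x ∈ τ, c x ∈ Icc (a x) (b x)) →
      IsSemialgebraicFunOn ℚ τ (fun x => F (Fin.snoc x (c x))) := by
    intro c hc hcm
    have hφ : IsSemialgebraicMapOn ℚ τ (fun x => (Fin.snoc x (c x) : Fin (N + 1) → ℝ)) := by
      refine IsSemialgebraicMapOn.of_forall hτ fun j => ?_
      refine Fin.lastCases ?_ (fun i => ?_) j
      · simpa using hc
      · simpa using isSemialgebraicFunOn_apply hτ i
    exact IsSemialgebraicFunOn.comp_isSemialgebraicMapOn_holds hF hφ
      fun x hx => KZlog.snoc_mem_band.mpr ⟨hx, hcm x hx⟩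
  have hgsa : IsSemialgebraicFunOn ℚ τ (fun x => F (Fin.snoc x (b x)) - F (Fin.snoc x (a x))) :=
    IsSemialgebraicFunOn.sub_holds (hmap hb fun x hx => Set.right_mem_Icc.mpr (hab x hx).le)
      (hmap ha fun x hx => Set.left_mem_Icc.mpr (hab x hx).le)
  -- integrability of the base integrand: Fubini and the fundamental theorem of calculus
  set G : (Fin (N + 1) → ℝ) → ℝ := (KZlog.band τ a b).indicator f with hG_def
  have hG : Integrable G := (integrable_indicator_iff hBm).mpr hfB
  obtain ⟨e, he, he_symm⟩ := exists_measurableEquiv_snoc N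
  have hG2 : Integrable (fun q : (Fin N → ℝ) × ℝ => G (Fin.snoc q.1 q.2))
      ((volume : Measure (Fin N → ℝ)).prod (volume : Measure ℝ)) := by
    have h := ((he.symm e).integrable_comp_emb e.symm.measurableEmbedding (g := G)).mpr hG
    convert h using 1
    ext q
    simp [he_symm]
  have hfib_in : ∀ x ∈ τ, (fun t => G (Fin.snoc x t)) =
      (Icc (a x) (b x)).indicator (fun t => f (Fin.snoc x t)) := by
    intro x hx
    ext t
    by_cases ht : t ∈ Icc (a x) (b x)
    · rw [indicator_of_mem ht, hG_def, indicator_of_mem (KZlog.snoc_mem_band.mpr ⟨hx, ht⟩)]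
    · rw [indicator_of_notMem ht, hG_def,
        indicator_of_notMem (fun h => ht (KZlog.snoc_mem_band.mp h).2)]
  have hgx : ∀ x ∈ τ, Integrable (fun t => G (Fin.snoc x t)) →
      F (Fin.snoc x (b x)) - F (Fin.snoc x (a x)) = ∫ t, G (Fin.snoc x t) := by
    intro x hx hxi
    rw [hfib_in x hx, integral_indicator measurableSet_Icc, integral_Icc_eq_integral_Ioc,
      ← intervalIntegral.integral_of_le (hab x hx).le]
    refine (intervalIntegral.integral_eq_sub_of_hasDerivAt_of_le (hab x hx).le (hcont x hx)
      (hder x hx) ?_).symm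
    rw [intervalIntegrable_iff_integrableOn_Icc_of_le (hab x hx).le]
    have h' := hxi
    rw [hfib_in x hx] at h'
    exact (integrable_indicator_iff measurableSet_Icc).mp h'
  have hgi : IntegrableOn (fun x => F (Fin.snoc x (b x)) - F (Fin.snoc x (a x))) τ := by
    refine Integrable.mono' hG2.integral_norm_prod_left.integrableOn.integrable
      (KZ.aestronglyMeasurable_of_isSemialgebraicFunOn hgsa hτm) ?_
    rw [ae_restrict_iff' hτm]
    filter_upwards [hG2.prod_right_ae] with x hx hxτ
    rw [hgx x hxτ hx]
    exact norm_integral_le_integral_norm _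
  let r' : KZ.IntegralRep N :=
    ⟨τ, fun x => F (Fin.snoc x (b x)) - F (Fin.snoc x (a x)), hτ, hgsa, hgi⟩
  have h23 : KZ.of r₂ - KZ.of r' ∈ KZ.relations :=
    KZ.newtonLeibnizRel_subset_relations ⟨N, r₂, r', a, b, F, hF, ha, hb,
      fun x hx => (hab x hx).le, rfl, hcont, hder, fun x _ => rfl, rfl⟩
  refine ⟨r', rfl, rfl, ?_⟩
  have : KZ.of r - KZ.of r' = (KZ.of r - KZ.of r₂) + (KZ.of r₂ - KZ.of r') := by abel
  rw [this]
  exact KZ.relations.add_mem h12 h23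

/-- **A pole-free variable drops out of the denominator**: with `v` not singular,
`D_{a,b,c}(insert_v t y) = D_{a',b',c'}(y)` for the contracted datum — independent of `t`. -/
theorem gzDen_insertNth (v : Fin (k + 1)) (a : Fin (k + 1) → Fin (k + 1) → ℕ) (b c : Fin (k + 1) → ℕ)
    (hv : ¬ Singular a b c v) (t : ℝ) (y : Fin k → ℝ) :
    gzDen a b c (v.insertNth t y : Fin (k + 1) → ℝ) =
      gzDen (fun i j => a (v.succAbove i) (v.succAbove j)) (fun i => b (v.succAbove i))
        (fun i => c (v.succAbove i)) y := by
  rw [not_singular_iff] at hv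
  obtain ⟨hb, hc, ha⟩ := hv
  have hrow : ∀ i : Fin k,
      (if v < v.succAbove i then (t - y i) ^ a v (v.succAbove i) else (1 : ℝ)) = 1 := by
    intro i
    split_ifs with h
    · rw [(ha _).1 h, pow_zero]
    · rfl
  have hcol : ∀ i : Fin k,
      (if v.succAbove i < v then (y i - t) ^ a (v.succAbove i) v else (1 : ℝ)) = 1 := by
    intro i
    split_ifs with h
    · rw [(ha _).2 h, pow_zero]
    · rfl
  simp only [gzDen, Fin.prod_univ_succAbove _ v, Fin.insertNth_apply_same,
    Fin.insertNth_apply_succAbove, hb, hc, pow_zero, one_mul, lt_self_iff_false, if_false, hrow, hcol,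
    Finset.prod_const_one, (Fin.strictMono_succAbove v).lt_iff_lt]

/-- **Elimination of a pole-free variable.** If `g = [Δ_{k+1}, P/D_{a,b,c}]` and the variable `v`
carries no pole, then `g` is KZ-equivalent (one change of variables — the coordinate permutation
`moveLast v` — and one Newton–Leibniz move with the RATIONAL primitive `antider(P̃)/D'`, `D'` free of
the integration variable) to `[Δ_k, P'/D_{a',b',c'}]` for the contracted datum and a polynomial `P'`.
Every intermediate integrand is absolutely integrable (Fubini inside `newtonLeibniz_pack`).
[Kontsevich–Zagier 2001, §1.2, rules (2), (3)] -/
theorem eliminate (k : ℕ) (v : Fin (k + 1)) (g : KZ.IntegralRep (k + 1))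
    (p : MvPolynomial (Fin (k + 1)) ℚ) (a : Fin (k + 1) → Fin (k + 1) → ℕ) (b c : Fin (k + 1) → ℕ)
    (hv : ¬ Singular a b c v)
    (hdom : g.domain = KZ.openOrderedSimplex (k + 1))
    (hint : EqOn g.integrand (fun t => (aeval t p : ℝ) / gzDen a b c t) g.domain) :
    ∃ (g' : KZ.IntegralRep k) (p' : MvPolynomial (Fin k) ℚ),
      g'.domain = KZ.openOrderedSimplex k ∧
      EqOn g'.integrand (fun t => (aeval t p' : ℝ) /
        gzDen (fun i j => a (v.succAbove i) (v.succAbove j)) (fun i => b (v.succAbove i))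
          (fun i => c (v.succAbove i)) t) g'.domain ∧
      KZ.of g - KZ.of g' ∈ KZ.relations := by
  -- Step A: the coordinate permutation bringing `v` to the last slot
  have hrel₁ : KZ.of g - KZ.of (g.reindex (moveLast v)) ∈ KZ.relations :=
    KZ.of_sub_of_reindex_mem_relations g (moveLast v)
  have hτ : IsSemialgebraic ℚ (KZ.openOrderedSimplex k) := KZ.isSemialgebraic_openOrderedSimplex k
  have hlo := isSemialgebraicFunOn_lo (k := k) v
  have hhi := isSemialgebraicFunOn_hi (k := k) v
  have hd₁ : (g.reindex (moveLast v)).domain =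
      {z | (Fin.init z : Fin k → ℝ) ∈ KZ.openOrderedSimplex k ∧ lo v (Fin.init z) < z (Fin.last k) ∧
        z (Fin.last k) < hi v (Fin.init z)} := by
    ext w
    rw [KZ.IntegralRep.reindex_domain, hdom, mem_setOf_eq, mem_setOf_eq, comp_moveLast,
      insertNth_mem_simplex_iff]
  -- the denominator after reindexing: a polynomial in the first `k` coordinates only
  have hDeval : ∀ z : Fin (k + 1) → ℝ,
      (aeval z (rename Fin.castSucc (gzDenP (fun i j => a (v.succAbove i) (v.succAbove j))
        (fun i => b (v.succAbove i)) (fun i => c (v.succAbove i)))) : ℝ) =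
      gzDen (fun i j => a (v.succAbove i) (v.succAbove j)) (fun i => b (v.succAbove i))
        (fun i => c (v.succAbove i)) (Fin.init z) := by
    intro z
    rw [aeval_rename]
    exact aeval_gzDenP _ _ _ _
  have hDne : ∀ z ∈ KZlog.band (KZ.openOrderedSimplex k) (lo v) (hi v),
      (aeval z (rename Fin.castSucc (gzDenP (fun i j => a (v.succAbove i) (v.succAbove j))
        (fun i => b (v.succAbove i)) (fun i => c (v.succAbove i)))) : ℝ) ≠ 0 := by
    intro z hz
    rw [hDeval]
    exact gzDen_ne_zero _ _ _ hz.1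
  have hband : IsSemialgebraic ℚ (KZlog.band (KZ.openOrderedSimplex k) (lo v) (hi v)) :=
    KZlog.isSemialgebraic_band hlo hhi
  -- abbreviations (as terms, to keep the statement of the pack syntactic)
  set D : MvPolynomial (Fin (k + 1)) ℚ := rename Fin.castSucc (gzDenP
    (fun i j => a (v.succAbove i) (v.succAbove j)) (fun i => b (v.succAbove i))
    (fun i => c (v.succAbove i))) with hD
  set Pt : MvPolynomial (Fin (k + 1)) ℚ := rename (moveLast v) p with hPt
  set Pa : MvPolynomial (Fin (k + 1)) ℚ := antider (Fin.last k) Pt with hPa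
  -- Step B: the Newton–Leibniz move in the last variable with the rational primitive `Pa / D`
  obtain ⟨r', hd', hi', hrel₂⟩ := newtonLeibniz_pack hτ hlo hhi (fun y hy => lo_lt_hi v hy)
    (f := fun z => (aeval z Pt : ℝ) / aeval z D) (F := fun z => (aeval z Pa : ℝ) / aeval z D)
    (isSemialgebraicFunOn_aeval_div_aeval hband Pt D hDne)
    (isSemialgebraicFunOn_aeval_div_aeval hband Pa D hDne)
    (fun x _ => by
      have h : (fun t : ℝ => (aeval (Fin.snoc x t : Fin (k + 1) → ℝ) Pa : ℝ) /
          aeval (Fin.snoc x t : Fin (k + 1) → ℝ) D) =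
          fun t => (aeval (Fin.snoc x t : Fin (k + 1) → ℝ) Pa : ℝ) /
            gzDen (fun i j => a (v.succAbove i) (v.succAbove j)) (fun i => b (v.succAbove i))
              (fun i => c (v.succAbove i)) x := by
        funext t
        rw [hDeval, Fin.init_snoc]
      rw [h]
      exact (((continuous_aeval_real Pa).comp (continuous_snoc x)).div_const _).continuousOn)
    (fun x _ t _ => by
      have h := KZ.hasDerivAt_aeval_update Pa (Fin.snoc x t) (Fin.last k) t
      simp only [Fin.update_snoc_last, hPa, pderiv_antider] at h
      have h' := h.div_const (gzDen (fun i j => a (v.succAbove i) (v.succAbove j))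
        (fun i => b (v.succAbove i)) (fun i => c (v.succAbove i)) x)
      have hfun : (fun s : ℝ => (aeval (Fin.snoc x s : Fin (k + 1) → ℝ) Pa : ℝ) /
          aeval (Fin.snoc x s : Fin (k + 1) → ℝ) D) =
          fun s => (aeval (Fin.snoc x s : Fin (k + 1) → ℝ) (antider (Fin.last k) Pt) : ℝ) /
            gzDen (fun i j => a (v.succAbove i) (v.succAbove j)) (fun i => b (v.succAbove i))
              (fun i => c (v.succAbove i)) x := by
        funext s
        rw [hDeval, Fin.init_snoc]
      rw [hfun, hDeval, Fin.init_snoc]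
      exact h')
    (g.reindex (moveLast v)) hd₁
    (by
      intro w hw
      have hw' : (fun i => w (moveLast v i)) ∈ g.domain := hw
      show g.integrand (fun i => w (moveLast v i)) = (aeval w Pt : ℝ) / aeval w D
      rw [hint hw']
      dsimp only
      rw [hPt, aeval_rename, Function.comp_def, hDeval, comp_moveLast, gzDen_insertNth v a b c hv])
  refine ⟨r', bind₁ (Fin.snoc (fun i : Fin k => (X i : MvPolynomial (Fin k) ℚ)) (hiP v)) Pa -
      bind₁ (Fin.snoc (fun i : Fin k => (X i : MvPolynomial (Fin k) ℚ)) (loP v)) Pa, hd', ?_, ?_⟩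
  · intro x _
    rw [hi']
    simp only [map_sub, aeval_bind₁_snoc, aeval_hiP, aeval_loP, hDeval, Fin.init_snoc, sub_div]
  · have : KZ.of g - KZ.of r' =
        (KZ.of g - KZ.of (g.reindex (moveLast v))) + (KZ.of (g.reindex (moveLast v)) - KZ.of r') := by
      abel
    rw [this]
    exact KZ.relations.add_mem hrel₁ hrel₂

/-- **Support collapse.** A genus-zero representation `g = [Δ_k, P/D_{a,b,c}]` all of whose poles
involve only variables of `S` is KZ-equivalent to a SATURATED genus-zero representation (every
variable carries a pole) of dimension `≤ #S`, by `k - #S'` eliminations (`eliminate`), `S' ⊆ S` the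
set of singular variables. [Kontsevich–Zagier 2001, §1.2] -/
theorem supportCollapse : ∀ (k : ℕ) (g : KZ.IntegralRep k) (p : MvPolynomial (Fin k) ℚ)
    (a : Fin k → Fin k → ℕ) (b c : Fin k → ℕ) (S : Finset (Fin k)),
    (∀ i, i ∉ S → ¬ Singular a b c i) →
    g.domain = KZ.openOrderedSimplex k →
    EqOn g.integrand (fun t => (aeval t p : ℝ) / gzDen a b c t) g.domain →
    ∃ (l : ℕ) (x : KZ.IntegralRep l) (p₁ : MvPolynomial (Fin l) ℚ) (a₁ : Fin l → Fin l → ℕ)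
      (b₁ c₁ : Fin l → ℕ),
      l ≤ S.card ∧ (∀ i, Singular a₁ b₁ c₁ i) ∧ x.domain = KZ.openOrderedSimplex l ∧
      EqOn x.integrand (fun t => (aeval t p₁ : ℝ) / gzDen a₁ b₁ c₁ t) x.domain ∧
      KZ.of g - KZ.of x ∈ KZ.relations := by
  intro k
  induction k with
  | zero =>
    intro g p a b c S _ hdom hint
    exact ⟨0, g, p, a, b, c, Nat.zero_le _, fun i => i.elim0, hdom, hint,
      by rw [sub_self]; exact KZ.relations.zero_mem⟩
  | succ k ih =>
    intro g p a b c S hS hdom hint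
    by_cases hall : ∀ i, Singular a b c i
    · refine ⟨k + 1, g, p, a, b, c, ?_, hall, hdom, hint, by rw [sub_self]; exact KZ.relations.zero_mem⟩
      have hSu : S = Finset.univ :=
        Finset.eq_univ_iff_forall.mpr fun i => by_contra fun h => hS i h (hall i)
      rw [hSu, Finset.card_univ, Fintype.card_fin]
    · push Not at hall
      obtain ⟨v, hv⟩ := hall
      obtain ⟨g', p', hd', hi', hrel⟩ := eliminate k v g p a b c hv hdom hint
      obtain ⟨l, x, p₁, a₁, b₁, c₁, hl, hsat, hxd, hxi, hrel'⟩ := ih g' p' _ _ _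
        (Finset.univ.filter fun i => v.succAbove i ∈ S)
        (fun i hi hsing => hS _ (by simpa using hi) (singular_of_contract hsing)) hd' hi'
      refine ⟨l, x, p₁, a₁, b₁, c₁, hl.trans ?_, hsat, hxd, hxi, ?_⟩
      · exact Finset.card_le_card_of_injOn (fun i => v.succAbove i) (fun i hi => by simpa using hi)
          Fin.succAbove_right_injective.injOn
      · have : KZ.of g - KZ.of x = (KZ.of g - KZ.of g') + (KZ.of g' - KZ.of x) := by abel
        rw [this]
        exact KZ.relations.add_mem hrel hrel'

open KZ in
/-- Support collapse in the LITERAL language of item 27223 (domain and integrand spelled out, the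
freeness of the variables outside `S` as equations, saturation as the disjunction), with the value. -/
theorem collapse_literal {k : ℕ} (g : IntegralRep k) (p : MvPolynomial (Fin k) ℚ)
    (a : Fin k → Fin k → ℕ) (b c : Fin k → ℕ) (S : Finset (Fin k))
    (hS : ∀ i, i ∉ S → b i = 0 ∧ c i = 0 ∧ ∀ j, (i < j → a i j = 0) ∧ (j < i → a j i = 0))
    (hdom : g.domain = {t | (∀ i, 0 < t i) ∧ (∀ i, t i < 1) ∧ StrictAnti t})
    (hint : EqOn g.integrand (fun t => (MvPolynomial.aeval t p : ℝ) /
      ((∏ i, t i ^ b i) * (∏ i, (1 - t i) ^ c i) * ∏ i, ∏ j, if i < j then (t i - t j) ^ a i j else 1)) g.domain) :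
    ∃ (l : ℕ) (x : IntegralRep l) (p₁ : MvPolynomial (Fin l) ℚ) (a₁ : Fin l → Fin l → ℕ) (b₁ c₁ : Fin l → ℕ),
      l ≤ S.card ∧ (∀ i, b₁ i ≠ 0 ∨ c₁ i ≠ 0 ∨ ∃ j, (i < j ∧ a₁ i j ≠ 0) ∨ (j < i ∧ a₁ j i ≠ 0)) ∧
      x.domain = {t | (∀ i, 0 < t i) ∧ (∀ i, t i < 1) ∧ StrictAnti t} ∧
      EqOn x.integrand (fun t => (MvPolynomial.aeval t p₁ : ℝ) /
        ((∏ i, t i ^ b₁ i) * (∏ i, (1 - t i) ^ c₁ i) * ∏ i, ∏ j, if i < j then (t i - t j) ^ a₁ i j else 1)) x.domain ∧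
      x.value = g.value ∧ of g - of x ∈ relations := by
  obtain ⟨l, x, p₁, a₁, b₁, c₁, hl, hsat, hxd, hxi, hrel⟩ :=
    supportCollapse k g p a b c S (fun i hi => not_singular_iff.mpr (hS i hi)) hdom hint
  exact ⟨l, x, p₁, a₁, b₁, c₁, hl, hsat, hxd, hxi, (KZ.Equivalent.value_eq_holds hrel).symm, hrel⟩

/-- Bookkeeping in the free abelian group: transporting a descent identity along two equivalences. -/
theorem transport {A : Type*} [AddCommGroup A] {R : AddSubgroup A} {s s₁ g g₁ X : A}
    (hs : s - s₁ ∈ R) (hg : g - g₁ ∈ R) (h : s₁ - g₁ - X ∈ R) : s - g - X ∈ R := by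
  have e : s - g - X = (s - s₁) - (g - g₁) + (s₁ - g₁ - X) := by abel
  rw [e]
  exact R.add_mem (R.sub_mem hs hg) h

end Summit.KontsevichZagierPeriods.KontsevichZagierPeriods.Theorems.RootDecompZetaThreeFrontierSupportCollapse
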